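import Mathlib.Tactic.DeriveFintype
import Literature.Computability.Complexity.StringEquality
import HarnessLib

/-!
# Polynomial-time case distinction: `z ↦ if c z then f z else g z` is in `FP` (trunk CplxCore)

Toolkit for assembling polynomial-time string functions from the tree's `FinTM2` combinators
without programming machines (companion of `StringCopy.lean` — `copyFn`, `P` closed under
`∩`/`∪` —, `StringSwap.lean`, `StringEquality.lean` — the fan-out `fanoutFn f g : z ↦ ⟨f z, g z⟩`).
The one missing structural combinator is **branching on a computed bit**:

* `iteFn c f g`, with `iteFn_apply`: if `c z = [b]` then `iteFn c f g z = if b then f z else g z`,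
  and `iteFn_mem_FP`: `c, f, g ∈ FP ⟹ iteFn c f g ∈ FP`.

Both branches are evaluated (`fanoutFn c (fanoutFn f g) z = ⟨c z, ⟨f z, g z⟩⟩`) and a
finite-state transducer `sel2T` reading the tag selects the first or the second field — the
finite-control step "according to the bit just computed, continue with subroutine 1 or 2"
(Arora–Barak 2009, §1.3), for total polynomial-time `f`, `g`. Also provided: the constant maps
(`const_mem_FP`) and prepending a fixed bit (`cons_mem_FP`), as one-line transducers.

## References

* S. Arora, B. Barak, *Computational Complexity: A Modern Approach*, CUP 2009, §1.3 (machine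
  constructions, finite control).
* J. E. Hopcroft, J. D. Ullman, *Introduction to Automata Theory, Languages, and Computation*,
  1979, §2.7 (Mealy machines).
-/

namespace Literature.Computability.Complexity

open _root_.Computability

namespace Branching

/-- States of the selection transducer `sel2T`: the tag field `bb01` (`t0`, `t1 b`, `t2 b`,
`t3 b`), then either keep the doubled first field and drop the rest (`keepEv`, `keepOd`, `drain`)
or skip it and copy the rest (`skipEv`, `skipOd`, `copy`). [folklore] -/
inductive S
  | t0
  | t1 (b : Bool)
  | t2 (b : Bool)
  | t3 (b : Bool)
  | keepEv
  | keepOd (b : Bool)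
  | drain
  | skipEv
  | skipOd (b : Bool)
  | copy
  deriving DecidableEq, Fintype

/-- Transition of `sel2T` (see `S`). [folklore] -/
def step : S → Bool → S × List Bool
  | .t0, b => (.t1 b, [])
  | .t1 b, _ => (.t2 b, [])
  | .t2 b, _ => (.t3 b, [])
  | .t3 b, _ => (if b then .keepEv else .skipEv, [])
  | .keepEv, b => (.keepOd b, [])
  | .keepOd b, b' => if b = b' then (.keepEv, [b]) else (.drain, [])
  | .drain, _ => (.drain, [])
  | .skipEv, b => (.skipOd b, [])
  | .skipOd b, b' => if b = b' then (.skipEv, []) else (.copy, [])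
  | .copy, c => (.copy, [c])

/-- **The selection transducer**: `⟨[b], ⟨A, B⟩⟩ ↦ A` if `b = 1`, `↦ B` if `b = 0`
(`sel2T_eval`). [Arora–Barak 2009, §1.3 (finite control)] [cite: AroraBarak2009, §1.3] -/
def sel2T : FST S Bool Bool where
  init := .t0
  step := step
  front := fun _ => []
  keep := fun _ => true

/-- The transition of `sel2T` (definitional). [folklore] -/
@[simp] theorem sel2T_step (s : S) (b : Bool) : sel2T.step s b = step s b := rfl

/-- The absorbing state emits nothing. [folklore] -/
theorem run_drain (l : List Bool) : (sel2T.run .drain l).2 = [] := by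
  induction l with
  | nil => rfl
  | cons b l ih => simp [FST.run_cons, step, ih]

/-- The copier. [folklore] -/
theorem run_copy (l : List Bool) : (sel2T.run .copy l).2 = l := by
  induction l with
  | nil => rfl
  | cons b l ih => simp [FST.run_cons, step, ih]

/-- Keeping the first field: from `keepEv` on `⟨A, B⟩` the transducer emits `A`. [folklore] -/
theorem run_keepEv (A B : List Bool) : (sel2T.run .keepEv (boolPair A B)).2 = A := by
  induction A with
  | nil => simp [boolPair, FST.run_cons, step, run_drain]
  | cons b A ih =>
    have hc : boolPair (b :: A) B = b :: b :: boolPair A B := by simp [boolPair]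
    rw [hc]
    simp [FST.run_cons, step, ih]

/-- Skipping the first field: from `skipEv` on `⟨A, B⟩` the transducer emits `B`. [folklore] -/
theorem run_skipEv (A B : List Bool) : (sel2T.run .skipEv (boolPair A B)).2 = B := by
  induction A with
  | nil => simp [boolPair, FST.run_cons, step, run_copy]
  | cons b A ih =>
    have hc : boolPair (b :: A) B = b :: b :: boolPair A B := by simp [boolPair]
    rw [hc]
    simp [FST.run_cons, step, ih]

/-- **`sel2T ⟨[b], ⟨A, B⟩⟩ = if b then A else B`.** [Arora–Barak 2009, §1.3] [cite: AroraBarak2009, §1.3] -/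
theorem sel2T_eval (b : Bool) (A B : List Bool) :
    sel2T.eval (boolPair [b] (boolPair A B)) = if b then A else B := by
  have he : ∀ l, sel2T.eval l = (sel2T.run .t0 l).2 := fun l => by simp [FST.eval, sel2T]
  have hc : boolPair [b] (boolPair A B) = b :: b :: false :: true :: boolPair A B := by
    simp [boolPair]
  rw [he, hc]
  cases b
  · simp [FST.run_cons, step, run_skipEv]
  · simp [FST.run_cons, step, run_keepEv]

/-- The constant transducer with value `w`. [folklore] -/
def constT (w : List Bool) : FST Unit Bool Bool where
  init := ()
  step := fun _ _ => ((), [])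
  front := fun _ => w
  keep := fun _ => false

/-- `constT w` computes the constant `w`. [folklore] -/
@[simp] theorem constT_eval (w l : List Bool) : (constT w).eval l = w := by
  simp [FST.eval, constT]

/-- The transducer prepending the bit `b` (named apart from `LenCmp.consT` of `LengthCompare.lean`,
which inserts a bit after the separator of a pair). [folklore] -/
def consBitT (b : Bool) : FST Unit Bool Bool where
  init := ()
  step := fun _ c => ((), [c])
  front := fun _ => [b]
  keep := fun _ => true

/-- `consBitT b` computes `List.cons b`. [folklore] -/
@[simp] theorem consBitT_eval (b : Bool) (l : List Bool) : (consBitT b).eval l = b :: l := by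
  have h : ∀ l : List Bool, ((consBitT b).run () l).2 = l := by
    intro l
    induction l with
    | nil => rfl
    | cons c l ih => simpa [FST.run_cons, consBitT] using ih
  have he : (consBitT b).eval l = [b] ++ ((consBitT b).run () l).2 := by simp [FST.eval, consBitT]
  rw [he, h]
  rfl

end Branching

open Branching

/-- **Constant string functions are in `FP`** (a transducer that discards its input and emits
`w`). This is the canonical toolkit statement; `AlgebraicComplexity/RealTauConjectureDefinable.lean`
carries the identical construction and proof as `TavRecode.constT` / `TavRecode.const_mem_FP`
(that file imports `RealTauConjectureProofs` and the counting hierarchy, so it cannot serve the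
toolkit); a librarian refactor should retarget those to this file. [Arora–Barak 2009, §1.3] [cite: AroraBarak2009, §1.3] -/
theorem const_mem_FP (w : List Bool) : (fun _ : List Bool => w) ∈ FP := by
  have h : (fun _ : List Bool => w) = (constT w).eval := funext fun l => (constT_eval w l).symm
  rw [h]
  exact (constT w).polyTimeComputable_eval

/-- **Prepending a fixed bit is in `FP`.** [Arora–Barak 2009, §1.3] [cite: AroraBarak2009, §1.3] -/
theorem cons_mem_FP (b : Bool) : (List.cons b : List Bool → List Bool) ∈ FP := by
  have h : (List.cons b : List Bool → List Bool) = (consBitT b).eval :=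
    funext fun l => (consBitT_eval b l).symm
  rw [h]
  exact (consBitT b).polyTimeComputable_eval

/-- **Branching on a computed bit**: `iteFn c f g z` evaluates the condition `c z` (expected to
be a one-bit string), both branches `f z`, `g z`, and selects with `sel2T`:
`sel2T ⟨c z, ⟨f z, g z⟩⟩`. [Arora–Barak 2009, §1.3] [cite: AroraBarak2009, §1.3] -/
noncomputable def iteFn (c f g : List Bool → List Bool) : List Bool → List Bool :=
  sel2T.eval ∘ fanoutFn c (fanoutFn f g)

/-- **`iteFn c f g z = if b then f z else g z` when `c z = [b]`.** [folklore] -/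
theorem iteFn_apply {c f g : List Bool → List Bool} {z : List Bool} {b : Bool} (h : c z = [b]) :
    iteFn c f g z = if b then f z else g z := by
  simp only [iteFn, Function.comp_apply, fanoutFn_apply, h, sel2T_eval]

/-- `iteFn` with a true condition. [folklore] -/
theorem iteFn_apply_true {c f g : List Bool → List Bool} {z : List Bool} (h : c z = [true]) :
    iteFn c f g z = f z := by
  rw [iteFn_apply h, if_pos rfl]

/-- `iteFn` with a false condition. [folklore] -/
theorem iteFn_apply_false {c f g : List Bool → List Bool} {z : List Bool} (h : c z = [false]) :
    iteFn c f g z = g z := by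
  rw [iteFn_apply h]
  rfl

/-- **`iteFn c f g ∈ FP` for `c, f, g ∈ FP`** (fan-out twice, then the selection transducer).
[Arora–Barak 2009, §1.3] [cite: AroraBarak2009, §1.3] -/
theorem iteFn_mem_FP {c f g : List Bool → List Bool} (hc : c ∈ FP) (hf : f ∈ FP) (hg : g ∈ FP) :
    iteFn c f g ∈ FP :=
  comp_mem_FP sel2T.polyTimeComputable_eval (fanoutFn_mem_FP hc (fanoutFn_mem_FP hf hg))

-- Only `iteFn_apply*`/`iteFn_mem_FP` are meant to be used; blocking `δ`-reduction keeps
-- definitional unfolding of large nested case distinctions cheap.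
attribute [irreducible] iteFn

end Literature.Computability.Complexity
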